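import Summits.HubbardSuperconductivity.HubbardSuperconductivity.Theorems.JosephsonMirrorJmInterchangeRateFormFloors

/-!
# Route `JosephsonMirror` — crux `JmInterchange` (stmt-HubbardSuperconductivity-2227), line `Sketch`:
# THE INTERCHANGE IN RATE FORM — mesoscopic Josephson gain + two-sector isolation ⇒ the ground-floor pair bridge

Lead c2.  The filed crux asks: uniform linear Josephson gain `a J L² ≤ E_L(0) - E_L(J)` of the window double for
every FIXED `J ∈ (0, J₀]`, eventually in `L` (onset `L₀(J)` unrestricted) ⇒ eventually a unit ground-floor pair
`φ ∈ G(N_L, 0)`, `χ ∈ G(N_L - 2, 0)` with `|⟨χ, Δ_d φ⟩|² ≥ a' L⁴`.  That form is an energy-DENSITY statement and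
is equivalent to two open single-layer residues (`jmInterchange_iff_reachesFloor_and_bridges`).  This file proves
the interchange when the gain is read at a MESOSCOPIC coupling instead:

`floorBridge_of_mesoscopicGain` (finite volume, explicit constants): for every `a > 0` there is `κ₀ = κ₀(a) > 0`
such that for every even `L ≥ 4`, `δ ∈ (0, 1/2)`, `U`, and every `J, γ > 0` with `J L² ≤ κ₀ γ`: if both sector
floors `G(N_L, 0)`, `G(N_L - 2, 0)` of `hubbardTorus 2 L 1 U` are isolated by `γ` inside their sectors
(`(e(n) + γ) ‖w‖² ≤ Re ⟨w, H w⟩` for `w ∈ szSector n 0` orthogonal to the floor, `n ∈ {N_L, N_L - 2}`) and the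
window double gains `a J L² ≤ E_L(0) - E_L(J)` at THIS `J`, then some unit ground-floor pair has
`|⟨χ, Δ_d φ⟩|² ≥ (a/4) L⁴`.  So with a sector gap `γ_L` and any coupling `J_L = o(γ_L / L²)` (e.g. `J_L = c L⁻⁴`
when `γ_L L² → ∞`), gain at `J_L` IS the Penrose–Onsager bridge (`floorBridge_of_rateGain_of_sectorGaps`, the
asymptotic corollary in the route's idiom); the converse (bridge ⇒ gain for ALL `J ≥ 0`, onset uniform) is the
landed `jmPairBridgeGivesGain_proof`.  Reading: the mirror's cusp decides the floors exactly when it is read at the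
Koma–Tasaki tower scale; at fixed `J` (the filed hypothesis) it is blind below that scale.

Proof: take the PSD minimiser `ψ_W` of the `J`-problem (`jmPositiveMinimiser_proof`); Feynman–Hellmann gives
`a L² ≤ Re ⟨ψ, K ψ⟩` and `Re ⟨ψ, H₀ ψ⟩ ≤ 2 e₀ + 2 J M` (`pigeonhole_inputs_of_gain`, `M = C² L²`); if NO unit floor
pair had `|⟨χ, Δ_d φ⟩|² ≥ (a/4) L⁴`, the floor-to-floor transfer bounds `‖P D P v‖², ‖P Dᴴ P v‖² ≤ (a/4) L² ‖v‖²`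
would hold for the projection `P` onto the two floors (`pairing_sq_le_of_noBridge`), and the engine
`re_coupling_le_floor_add_leak` (gap in variance form from `variance_gap_of_sectorGap`) would give
`Re ⟨ψ, K ψ⟩ ≤ (a/2) L² + (a/8) L² + (a/8) L²` for `J L² ≤ κ₀ γ` — a contradiction.

Sources: T. Koma, H. Tasaki, J. Stat. Phys. 76 (1994) 745; H. Tasaki, J. Stat. Phys. 174 (2019) 735 (tower
states, §3.4); E. H. Lieb, PRL 62 (1989) 1201; T. Kato (1966) II §5.  No new definitions.
-/

-- the mandated namespace `Summit.<Summit>.<Problem>.Theorems` repeats `HubbardSuperconductivity`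
-- (single-problem summit, D-0017), which the `dupNamespace` linter flags on every declaration
set_option linter.dupNamespace false

namespace Summit.HubbardSuperconductivity.HubbardSuperconductivity.Theorems.JosephsonMirror

open Matrix Literature.MathematicalPhysics.QuantumLattice Filter
open Literature.MathematicalPhysics.QuantumLattice.EigenvalueContinuation
open scoped Kronecker ComplexOrder Matrix.Norms.L2Operator Topology

/-- **The interchange in rate form, finite volume.**  For every `a > 0` there is `κ₀ > 0` such that: for even
`L ≥ 4`, `δ ∈ (0, 1/2)`, any `U`, and `J, γ > 0` with `J L² ≤ κ₀ γ`, if the sector floors of `(N_L, 0)` and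
`(N_L - 2, 0)` are isolated by `γ` inside their sectors and the window double (objects of `JmInterchange`,
verbatim) gains `a J L² ≤ E(0) - E(J)`, then some unit sector ground states `φ ∈ G(N_L, 0)`, `χ ∈ G(N_L - 2, 0)`
have `(a/4) L⁴ ≤ |⟨χ, Δ_d φ⟩|²`.  Koma–Tasaki (1994); Lieb (1989); Kato (1966) II §5. [folklore] -/
theorem floorBridge_of_mesoscopicGain (a : ℝ) (ha : 0 < a) :
    ∃ κ₀ : ℝ, 0 < κ₀ ∧ ∀ (L : ℕ) [NeZero L] (U δ J γ : ℝ), Even L → 4 ≤ L → δ ∈ Set.Ioo (0:ℝ) (1 / 2) →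
      0 < J → 0 < γ → J * (L : ℝ) ^ 2 ≤ κ₀ * γ →
      (∀ n : ℕ, (n = 2 * ⌊(1 - δ) * (L : ℝ) ^ 2 / 2⌋₊ ∨ n = 2 * ⌊(1 - δ) * (L : ℝ) ^ 2 / 2⌋₊ - 2) →
        ∀ w : Fock (Orb (FermionTorus 2 L)), w ∈ szSector n 0 →
          (∀ g : Fock (Orb (FermionTorus 2 L)), IsGroundStateInSector (hubbardTorus 2 L 1 U) n 0 g →
            star g ⬝ᵥ w = 0) →
          ((hubbardTorus 2 L 1 U).minEnergyOn (szSector n 0) + γ) * (star w ⬝ᵥ w).re ≤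
            (star w ⬝ᵥ (hubbardTorus 2 L 1 U *ᵥ w)).re) →
      (let ι : Type := Finset (Literature.MathematicalPhysics.QuantumLattice.Orb (Literature.MathematicalPhysics.QuantumLattice.FermionTorus 2 L)); let N : ℕ := 2 * ⌊(1 - δ) * (L : ℝ) ^ 2 / 2⌋₊; let H : Matrix ι ι ℂ := Literature.MathematicalPhysics.QuantumLattice.hubbardTorus 2 L 1 U; let μ : ℝ := (H.minEnergyOn (Literature.MathematicalPhysics.QuantumLattice.szSector N 0) - H.minEnergyOn (Literature.MathematicalPhysics.QuantumLattice.szSector (N - 2) 0)) / 2; let A : Matrix ι ι ℂ := Literature.MathematicalPhysics.QuantumLattice.hubbardTorusWith 2 L 1 U μ; let D : Matrix ι ι ℂ := ((L : ℂ))⁻¹ • Literature.MathematicalPhysics.QuantumLattice.pairField Literature.MathematicalPhysics.QuantumLattice.dWaveFormFactor L; let Hd : ℝ → Matrix (ι × ι) (ι × ι) ℂ := fun J => Matrix.kroneckerMap (fun a b : ℂ => a * b) A 1 + Matrix.kroneckerMap (fun a b : ℂ => a * b) 1 (Matrix.transpose A) - (J : ℂ) • (Matrix.kroneckerMap (fun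 a b : ℂ => a * b) D (Matrix.transpose (Matrix.conjTranspose D)) + Matrix.kroneckerMap (fun a b : ℂ => a * b) (Matrix.conjTranspose D) (Matrix.transpose D)); let good : ι × ι → Prop := fun p => ((p.1.card = N ∧ p.2.card = N) ∨ (p.1.card = N - 2 ∧ p.2.card = N - 2)) ∧ (p.1.filter (fun o => (ofLex o).2 = 0)).card = (p.1.filter (fun o => (ofLex o).2 = 1)).card ∧ (p.2.filter (fun o => (ofLex o).2 = 0)).card = (p.2.filter (fun o => (ofLex o).2 = 1)).card; let S : Submodule ℂ (ι × ι → ℂ) := ⨅ (p : ι × ι) (_ : ¬ good p), LinearMap.ker (LinearMap.proj (R := ℂ) (φ := fun _ : ι × ι => ℂ) p); let E : ℝ → ℝ := fun J => (Hd J).minEnergyOn S; a * J * (L : ℝ) ^ 2 ≤ E 0 - E J) →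
      ∃ φ χ : Fock (Orb (FermionTorus 2 L)),
        IsGroundStateInSector (hubbardTorus 2 L 1 U) (2 * ⌊(1 - δ) * (L : ℝ) ^ 2 / 2⌋₊) 0 φ ∧ star φ ⬝ᵥ φ = 1 ∧
        IsGroundStateInSector (hubbardTorus 2 L 1 U) (2 * ⌊(1 - δ) * (L : ℝ) ^ 2 / 2⌋₊ - 2) 0 χ ∧ star χ ⬝ᵥ χ = 1 ∧
        a / 4 * (L : ℝ) ^ 4 ≤ ‖star χ ⬝ᵥ Matrix.mulVec (pairField dWaveFormFactor L) φ‖ ^ 2 := by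
  -- the a-priori constant `C ≥ 1` with `‖Δ_d‖ ≤ C L²` in every volume
  obtain ⟨C, hC1, hCΔ⟩ : ∃ C : ℝ, 1 ≤ C ∧ ∀ (L : ℕ) [NeZero L],
      ‖pairField dWaveFormFactor L‖ ≤ C * (L : ℝ) ^ 2 := by
    refine ⟨max 1 (2 * ∑ e ∈ insert (0 : Literature.Probability.LatticeModels.Site 2) unitSteps,
      |dWaveFormFactor e / Real.sqrt 2|), le_max_left _ _,
      fun L _ => (norm_pairField_le dWaveFormFactor L).trans ?_⟩
    exact mul_le_mul_of_nonneg_right (le_max_right _ _) (by positivity)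
  have hC0 : 0 < C := by linarith
  -- the smallness constant
  refine ⟨a ^ 2 / (64 * C ^ 4 * (16 * C ^ 2 + a)), by positivity, ?_⟩
  intro L _ U δ J γ hE hL4 hδ hJ0 hγ hJγ hgapH hgain
  extract_lets ι N H μ A D Hd good S E at hgain
  -- suppose no floor pair reaches `(a/4) L⁴`
  by_contra hno
  push Not at hno
  -- the filling: `N = 2n` with `2 ≤ n ≤ L²`
  set n : ℕ := ⌊(1 - δ) * (L : ℝ) ^ 2 / 2⌋₊ with hn
  have hNn : N = 2 * n := rfl
  have hL4' : (4 : ℝ) ≤ L := by exact_mod_cast hL4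
  have hL0 : (0 : ℝ) < L := by linarith
  have hn2 : 2 ≤ n := by
    rw [hn]
    refine Nat.le_floor ?_
    rw [Nat.cast_ofNat, le_div_iff₀ (by norm_num : (0 : ℝ) < 2)]
    have hδ2 : 1 / 2 ≤ 1 - δ := by linarith [hδ.2]
    nlinarith [hδ2, hL4']
  have hnL : n ≤ L ^ 2 := by
    rw [hn]
    refine Nat.floor_le_of_le ?_
    have hδ0 : 1 - δ ≤ 1 := by linarith [hδ.1]
    have hL0' : (0 : ℝ) ≤ (L : ℝ) ^ 2 := by positivity
    push_cast
    nlinarith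
  have hn'L : n - 1 ≤ L ^ 2 := le_trans (Nat.sub_le n 1) hnL
  have hN2 : N - 2 = 2 * (n - 1) := by omega
  have hN4 : 4 ≤ N := by omega
  have hN2' : ((N - 2 : ℕ) : ℝ) = (N : ℝ) - 2 := by
    rw [Nat.cast_sub (by omega)]
    norm_num
  -- energies and the balancing chemical potential
  set e₁ : ℝ := H.minEnergyOn (szSector N 0) with he₁
  set e₂ : ℝ := H.minEnergyOn (szSector (N - 2) 0) with he₂
  have hμ : μ = (e₁ - e₂) / 2 := rfl
  set e₀ : ℝ := e₁ - μ * N with he₀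
  have he₀₂ : e₀ = e₂ - μ * ((N - 2 : ℕ) : ℝ) := by
    rw [hN2', he₀, hμ]
    ring
  have hAherm : A.IsHermitian := isHermitian_hamiltonianWith _ 1 U μ
  -- block predicates and the window
  set F : ι → Prop := fun s =>
    (s.filter fun o => (ofLex o).2 = 0).card = (s.filter fun o => (ofLex o).2 = 1).card with hF
  set P₁ : ι → Prop := fun s => s.card = N ∧ F s with hP₁
  set P₂ : ι → Prop := fun s => s.card = N - 2 ∧ F s with hP₂
  have h12 : ∀ s, P₁ s → ¬ P₂ s := by
    rintro s ⟨h1, -⟩ ⟨h2, -⟩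
    omega
  have hgood : ∀ s t, good (s, t) → (P₁ s ∧ P₁ t) ∨ (P₂ s ∧ P₂ t) := by
    rintro s t ⟨h | h, hs, ht⟩
    · exact Or.inl ⟨⟨h.1, hs⟩, ⟨h.2, ht⟩⟩
    · exact Or.inr ⟨⟨h.1, hs⟩, ⟨h.2, ht⟩⟩
  have hgood₁ : ∀ s t, P₁ s → P₁ t → good (s, t) := fun s t hs ht =>
    ⟨Or.inl ⟨hs.1, ht.1⟩, hs.2, ht.2⟩
  have hS : ∀ ψ, ψ ∈ S ↔ ∀ p, ¬ good p → ψ p = 0 := by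
    intro ψ
    simp only [S, Submodule.mem_iInf, LinearMap.mem_ker, LinearMap.proj_apply]
  -- block support ⇒ sector membership
  have hsec₁ : ∀ v : ι → ℂ, (∀ s, ¬ P₁ s → v s = 0) → v ∈ szSector N 0 := by
    intro v hv
    have hsec : IsInSector n n v := fun s hs => hv s fun h =>
      hs ((block_iff n s).1 (by simpa [hP₁, hF, hNn] using h))
    rw [hNn]
    exact (mem_szSector_two_mul_zero_iff n v).2 hsec
  have hsec₂ : ∀ v : ι → ℂ, (∀ s, ¬ P₂ s → v s = 0) → v ∈ szSector (N - 2) 0 := by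
    intro v hv
    have hsec : IsInSector (n - 1) (n - 1) v := fun s hs => hv s fun h =>
      hs ((block_iff (n - 1) s).1 (by simpa [hP₂, hF, hN2] using h))
    rw [hN2]
    exact (mem_szSector_two_mul_zero_iff (n - 1) v).2 hsec
  -- (1) the floor data: projection `P` onto the two floors, gaps in variance form, transfer bounds
  have hpair : ∀ φ χ : ι → ℂ,
      φ ∈ szSector N 0 ⊓ Module.End.eigenspace (Matrix.toLin' H) (((H.minEnergyOn (szSector N 0)) : ℝ) : ℂ) →
      χ ∈ szSector (N - 2) 0 ⊓ Module.End.eigenspace (Matrix.toLin' H)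
        (((H.minEnergyOn (szSector (N - 2) 0)) : ℝ) : ℂ) →
      ‖star χ ⬝ᵥ (pairField dWaveFormFactor L *ᵥ φ)‖ ^ 2 ≤
        (L : ℝ) ^ 2 * (a / 4 * (L : ℝ) ^ 2) * ((star χ ⬝ᵥ χ).re * (star φ ⬝ᵥ φ).re) := by
    intro φ χ hφ hχ
    have h := pairing_sq_le_of_noBridge U N (fun φ' χ' h1 h2 h3 h4 => hno φ' χ' h1 h2 h3 h4) φ χ hφ hχ
    have hb : a / 4 * (L : ℝ) ^ 4 = (L : ℝ) ^ 2 * (a / 4 * (L : ℝ) ^ 2) := by ring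
    rw [← hb]
    exact h
  obtain ⟨P, hPH, hPc, hgapH₁, hgapH₂, hs₁, hs₂⟩ :=
    floorProjectionData L U N hN4 γ (a / 4 * (L : ℝ) ^ 2) (by positivity) hgapH hpair
  -- (2) the gaps for the balanced layer `A = H - μ N`, `e₀ = e₁ - μ N = e₂ - μ (N - 2)`
  have hA_of_H : ∀ (m : ℕ) (v : ι → ℂ), v ∈ szSector m 0 →
      (star v ⬝ᵥ A *ᵥ v).re = (star v ⬝ᵥ H *ᵥ v).re - μ * (m : ℝ) * (star v ⬝ᵥ v).re := by
    intro m v hv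
    have hN : IsNParticle m v := ((mem_szSector_iff m 0 v).1 hv).1
    show (star v ⬝ᵥ hubbardTorusWith 2 L 1 U μ *ᵥ v).re = _
    rw [hubbardTorusWith_eq, sub_mulVec, smul_mulVec, totalNumber_mulVec_of_isNParticle hN, smul_smul,
      dotProduct_sub, dotProduct_smul, Complex.sub_re, smul_eq_mul, ← Complex.ofReal_natCast,
      ← Complex.ofReal_mul, Complex.re_ofReal_mul]
  have hgap₁ : ∀ v : ι → ℂ, (∀ s, ¬ P₁ s → v s = 0) →
      γ * (star ((1 - P) *ᵥ v) ⬝ᵥ ((1 - P) *ᵥ v)).re ≤ (star v ⬝ᵥ A *ᵥ v).re - e₀ * (star v ⬝ᵥ v).re := by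
    intro v hv
    have hvs := hsec₁ v hv
    have h := hgapH₁ v hvs
    rw [hA_of_H N v hvs, he₀]
    have : (star v ⬝ᵥ H *ᵥ v).re - μ * (N : ℝ) * (star v ⬝ᵥ v).re - (e₁ - μ * N) * (star v ⬝ᵥ v).re =
        (star v ⬝ᵥ H *ᵥ v).re - e₁ * (star v ⬝ᵥ v).re := by ring
    rw [this]
    exact h
  have hgap₂ : ∀ v : ι → ℂ, (∀ s, ¬ P₂ s → v s = 0) →
      γ * (star ((1 - P) *ᵥ v) ⬝ᵥ ((1 - P) *ᵥ v)).re ≤ (star v ⬝ᵥ A *ᵥ v).re - e₀ * (star v ⬝ᵥ v).re := by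
    intro v hv
    have hvs := hsec₂ v hv
    have h := hgapH₂ v hvs
    rw [hA_of_H (N - 2) v hvs, he₀₂]
    have : (star v ⬝ᵥ H *ᵥ v).re - μ * ((N - 2 : ℕ) : ℝ) * (star v ⬝ᵥ v).re -
        (e₂ - μ * ((N - 2 : ℕ) : ℝ)) * (star v ⬝ᵥ v).re =
        (star v ⬝ᵥ H *ᵥ v).re - e₂ * (star v ⬝ᵥ v).re := by ring
    rw [this]
    exact h
  -- (3) one-layer bounds `‖D v‖², ‖Dᴴ v‖² ≤ M ‖v‖²` with `M = C² L²` (`D = L⁻¹ Δ_d`)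
  obtain ⟨M, hM⟩ : ∃ M : ℝ, M = C ^ 2 * (L : ℝ) ^ 2 := ⟨_, rfl⟩
  have hM0 : 0 < M := by rw [hM]; positivity
  have hDn : ‖D‖ ^ 2 ≤ M := by
    have h1 : ‖D‖ ≤ C * L := by
      show ‖((L : ℂ))⁻¹ • pairField dWaveFormFactor L‖ ≤ C * L
      rw [norm_smul, norm_inv, Complex.norm_natCast, inv_mul_le_iff₀ hL0]
      calc ‖pairField dWaveFormFactor L‖ ≤ C * (L : ℝ) ^ 2 := hCΔ L
        _ = (L : ℝ) * (C * L) := by ring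
    rw [hM]
    calc ‖D‖ ^ 2 ≤ (C * L) ^ 2 := pow_le_pow_left₀ (norm_nonneg _) h1 2
      _ = C ^ 2 * (L : ℝ) ^ 2 := by ring
  have hD : ∀ v : ι → ℂ, (star (D *ᵥ v) ⬝ᵥ (D *ᵥ v)).re ≤ M * (star v ⬝ᵥ v).re := fun v =>
    (re_star_mulVec_self_le_opNorm_sq D v).trans
      (mul_le_mul_of_nonneg_right hDn (Complex.nonneg_iff.1 (dotProduct_star_self_nonneg v)).1)
  have hDh : ∀ v : ι → ℂ, (star (Dᴴ *ᵥ v) ⬝ᵥ (Dᴴ *ᵥ v)).re ≤ M * (star v ⬝ᵥ v).re := fun v =>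
    (re_star_mulVec_self_le_opNorm_sq Dᴴ v).trans
      (mul_le_mul_of_nonneg_right ((Matrix.l2_opNorm_conjTranspose D).symm ▸ hDn)
        (Complex.nonneg_iff.1 (dotProduct_star_self_nonneg v)).1)
  -- (4) the trial state `φ ⊗ φ̄` of a sector-`N` ground state: `E(0) ≤ 2 e₀`
  obtain ⟨φ, hφsec, hφ1, hHφ⟩ := exists_unit_szSector_groundState L U hnL
  have hφP : ∀ s, ¬ P₁ s → φ s = 0 := fun s hs =>
    hφsec s fun h => hs (by simpa [hP₁, hF, hNn] using (block_iff n s).2 h)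
  have hφN : IsNParticle N φ := by
    have := hφsec.isNParticle
    rwa [← two_mul] at this
  have hHφ' : H *ᵥ φ = (e₁ : ℂ) • φ := hHφ
  have hAφ : A *ᵥ φ = (e₀ : ℂ) • φ := by
    show hubbardTorusWith 2 L 1 U μ *ᵥ φ = (e₀ : ℂ) • φ
    rw [hubbardTorusWith_eq, sub_mulVec, smul_mulVec, totalNumber_mulVec_of_isNParticle hφN,
      smul_smul]
    change H *ᵥ φ - _ = _
    rw [hHφ', ← sub_smul, he₀]
    push_cast
    rfl
  have hB := minEnergyOn_zero_le_of_eigen hAherm D P₁ good hgood₁ S hS hφP hφ1 hAφ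
  -- (5) the PSD minimiser of the `J`-problem and the Feynman–Hellmann inputs
  obtain ⟨W, V, hWV, hWsupp, hψ1, hψE⟩ :
      ∃ W V : Matrix ι ι ℂ, W = Vᴴ * V ∧ (∀ s t, ¬ good (s, t) → W s t = 0) ∧
        star (fun p : ι × ι => W p.1 p.2) ⬝ᵥ (fun p : ι × ι => W p.1 p.2) = 1 ∧
        (star (fun p : ι × ι => W p.1 p.2) ⬝ᵥ
            (A ⊗ₖ (1 : Matrix ι ι ℂ) + (1 : Matrix ι ι ℂ) ⊗ₖ Aᵀ -
              (J : ℂ) • (D ⊗ₖ Dᴴᵀ + Dᴴ ⊗ₖ Dᵀ)) *ᵥ (fun p : ι × ι => W p.1 p.2)).re =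
          (A ⊗ₖ (1 : Matrix ι ι ℂ) + (1 : Matrix ι ι ℂ) ⊗ₖ Aᵀ -
            (J : ℂ) • (D ⊗ₖ Dᴴᵀ + Dᴴ ⊗ₖ Dᵀ)).minEnergyOn S :=
    jmPositiveMinimiser_proof L U δ J hE hδ hJ0.le
  have hW : Wᴴ = W := by rw [hWV, conjTranspose_mul, conjTranspose_conjTranspose]
  have hψS : (fun p : ι × ι => W p.1 p.2) ∈ S := (hS _).2 fun p hp => hWsupp p.1 p.2 hp
  have hgain' : a * (L : ℝ) ^ 2 * J ≤
      (A ⊗ₖ (1 : Matrix ι ι ℂ) + (1 : Matrix ι ι ℂ) ⊗ₖ Aᵀ -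
          ((0 : ℝ) : ℂ) • (D ⊗ₖ Dᴴᵀ + Dᴴ ⊗ₖ Dᵀ)).minEnergyOn S -
        (A ⊗ₖ (1 : Matrix ι ι ℂ) + (1 : Matrix ι ι ℂ) ⊗ₖ Aᵀ -
          (J : ℂ) • (D ⊗ₖ Dᴴᵀ + Dᴴ ⊗ₖ Dᵀ)).minEnergyOn S := by
    have h : a * J * (L : ℝ) ^ 2 ≤
        (A ⊗ₖ (1 : Matrix ι ι ℂ) + (1 : Matrix ι ι ℂ) ⊗ₖ Aᵀ -
            ((0 : ℝ) : ℂ) • (D ⊗ₖ Dᴴᵀ + Dᴴ ⊗ₖ Dᵀ)).minEnergyOn S -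
          (A ⊗ₖ (1 : Matrix ι ι ℂ) + (1 : Matrix ι ι ℂ) ⊗ₖ Aᵀ -
            (J : ℂ) • (D ⊗ₖ Dᴴᵀ + Dᴴ ⊗ₖ Dᵀ)).minEnergyOn S := hgain
    linarith
  have hKM := couplingExpectBound D M (fun p : ι × ι => W p.1 p.2) hM0.le hD hDh
  obtain ⟨hH0, hKκ⟩ := pigeonhole_inputs_of_gain hAherm D hJ0 (by positivity : 0 ≤ a * (L : ℝ) ^ 2)
    S hψS hψ1 hψE hgain' hKM hB
  -- (6) the engine, with `l = a / (16 C²)`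
  have hl : 0 < a / (16 * C ^ 2) := by positivity
  have hK := re_coupling_le_floor_add_leak A D W P P₁ P₂ good e₀ M γ (2 * J * M) (a / 4 * (L : ℝ) ^ 2)
    (a / 4 * (L : ℝ) ^ 2) (a / (16 * C ^ 2)) hW hPH h12 hgood hWsupp hM0.le hγ hl hPc hgap₁ hgap₂ hD hDh hs₁ hs₂
    hψ1 hH0
  -- (7) the constants
  have ha0 : a ≠ 0 := ha.ne'
  have hC0' : C ≠ 0 := hC0.ne'
  have hγ0 : γ ≠ 0 := hγ.ne'
  have hMl : 2 * M * (a / (16 * C ^ 2)) = a / 8 * (L : ℝ) ^ 2 := by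
    rw [hM]; field_simp; ring
  have herr : (2 * M * (a / (16 * C ^ 2))⁻¹ + 2 * M) * (2 * (2 * J * M) / γ) ≤ a / 8 * (L : ℝ) ^ 2 := by
    have hkey : (2 * M * (a / (16 * C ^ 2))⁻¹ + 2 * M) * (2 * (2 * J * M) / γ) =
        (8 * C ^ 4 * (16 * C ^ 2 + a)) * (J * (L : ℝ) ^ 2) / (a * γ) * (L : ℝ) ^ 2 := by
      rw [hM]; field_simp; ring
    rw [hkey]
    have hJ' : (8 * C ^ 4 * (16 * C ^ 2 + a)) * (J * (L : ℝ) ^ 2) ≤ a ^ 2 * γ / 8 := by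
      have h := hJγ
      rw [div_mul_eq_mul_div, le_div_iff₀ (by positivity)] at h
      linarith
    have haγ : 0 < a * γ := mul_pos ha hγ
    calc (8 * C ^ 4 * (16 * C ^ 2 + a)) * (J * (L : ℝ) ^ 2) / (a * γ) * (L : ℝ) ^ 2
        ≤ (a ^ 2 * γ / 8) / (a * γ) * (L : ℝ) ^ 2 := by gcongr
      _ = a / 8 * (L : ℝ) ^ 2 := by field_simp
  have hcontra : a * (L : ℝ) ^ 2 ≤ 3 / 4 * (a * (L : ℝ) ^ 2) := by
    have := hKκ.trans hK
    rw [hMl] at this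
    linarith
  have : 0 < a * (L : ℝ) ^ 2 := by positivity
  linarith

/-- **THE INTERCHANGE IN RATE FORM** (asymptotic corollary, in the route's idiom; registered sub-goal
`rateFormInterchange` of line `Sketch`).  At `(U, δ)` with `δ ∈ (0, 1/2)`: if the sector floors of `(N_L, 0)` and
`(N_L - 2, 0)` of `hubbardTorus 2 L 1 U` are eventually isolated inside their sectors by `γ_L > 0`, and the window
double of `JmInterchange` (verbatim objects) eventually gains `a J_L L² ≤ E_L(0) - E_L(J_L)` at SOME couplings
`J_L > 0` with `J_L L² / γ_L → 0` (e.g. `J_L = c L⁻⁴` when `γ_L L² → ∞`), then the crux's conclusion holds with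
`a' = a/4`: eventually in even `L` some unit ground-floor pair `φ ∈ G(N_L, 0)`, `χ ∈ G(N_L - 2, 0)` has
`(a/4) L⁴ ≤ |⟨χ, Δ_d φ⟩|²`.  With the landed converse `jmPairBridgeGivesGain_proof` (bridge ⇒ gain for all `J ≥ 0`,
onset uniform in `J`): under two-sector isolation at a scale `γ_L`, the ground-floor pair bridge is EQUIVALENT to
mesoscopic Josephson gain at any coupling scale `o(γ_L L⁻²)` — the mirror's cusp read at the Koma–Tasaki tower
scale.  Koma–Tasaki, J. Stat. Phys. 76 (1994) 745; Tasaki, J. Stat. Phys. 174 (2019) 735; Lieb, PRL 62 (1989)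
1201. [folklore] -/
theorem rateFormInterchange : ∀ (U δ a : ℝ) (J γ : ℕ → ℝ), δ ∈ Set.Ioo (0:ℝ) (1 / 2) → 0 < a → (∀ L : ℕ, 0 < J L) → (∀ L : ℕ, 0 < γ L) → Filter.Tendsto (fun L : ℕ => J L * (L : ℝ) ^ 2 / γ L) Filter.atTop (nhds 0) → (∃ L₀ : ℕ, ∀ (L : ℕ) [NeZero L], Even L → L₀ ≤ L → (∀ n : ℕ, (n = 2 * ⌊(1 - δ) * (L : ℝ) ^ 2 / 2⌋₊ ∨ n = 2 * ⌊(1 - δ) * (L : ℝ) ^ 2 / 2⌋₊ - 2) → ∀ w : Fock (Orb (FermionTorus 2 L)), w ∈ szSector n 0 → (∀ g : Fock (Orb (FermionTorus 2 L)), IsGroundStateInSector (hubbardTorus 2 L 1 U) n 0 g → star g ⬝ᵥ w = 0) → ((hubbardTorus 2 L 1 U).minEnergyOn (szSector n 0) + γ L) * (star w ⬝ᵥ w).re ≤ (star w ⬝ᵥ (hubbardTorus 2 L 1 U *ᵥ w)).re)) → (∃ L₀ : ℕ, ∀ (L : ℕ) [NeZero L], Even L → L₀ ≤ L → (let ι :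 Type := Finset (Literature.MathematicalPhysics.QuantumLattice.Orb (Literature.MathematicalPhysics.QuantumLattice.FermionTorus 2 L)); let N : ℕ := 2 * ⌊(1 - δ) * (L : ℝ) ^ 2 / 2⌋₊; let H : Matrix ι ι ℂ := Literature.MathematicalPhysics.QuantumLattice.hubbardTorus 2 L 1 U; let μ : ℝ := (H.minEnergyOn (Literature.MathematicalPhysics.QuantumLattice.szSector N 0) - H.minEnergyOn (Literature.MathematicalPhysics.QuantumLattice.szSector (N - 2) 0)) / 2; let A : Matrix ι ι ℂ := Literature.MathematicalPhysics.QuantumLattice.hubbardTorusWith 2 L 1 U μ; let D : Matrix ι ι ℂ := ((L : ℂ))⁻¹ • Literature.MathematicalPhysics.QuantumLattice.pairField Literature.MathematicalPhysics.QuantumLattice.dWaveFormFactor L; let Hd : ℝ → Matrix (ι × ι) (ι × ι) ℂ := fun J => Matrix.kroneckerMap (fun a b : ℂ => a * b) A 1 + Matrix.kroneckerMap (fun a b : ℂ => a * b) 1 (Matrix.transpose A) - (J : ℂ) • (Matrix.kroneckerMap (fun a b : ℂ => a * b) D (Matrix.transpose (Matrix.conjTranspose D)) + Matrix.kroneckerMap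 (fun a b : ℂ => a * b) (Matrix.conjTranspose D) (Matrix.transpose D)); let good : ι × ι → Prop := fun p => ((p.1.card = N ∧ p.2.card = N) ∨ (p.1.card = N - 2 ∧ p.2.card = N - 2)) ∧ (p.1.filter (fun o => (ofLex o).2 = 0)).card = (p.1.filter (fun o => (ofLex o).2 = 1)).card ∧ (p.2.filter (fun o => (ofLex o).2 = 0)).card = (p.2.filter (fun o => (ofLex o).2 = 1)).card; let S : Submodule ℂ (ι × ι → ℂ) := ⨅ (p : ι × ι) (_ : ¬ good p), LinearMap.ker (LinearMap.proj (R := ℂ) (φ := fun _ : ι × ι => ℂ) p); let E : ℝ → ℝ := fun J => (Hd J).minEnergyOn S; a * J L * (L : ℝ) ^ 2 ≤ E 0 - E (J L))) → ∃ a' : ℝ, 0 < a' ∧ ∃ L₀ : ℕ, ∀ (L : ℕ) [NeZero L], Even L → L₀ ≤ L → ∃ φ χ : Literature.MathematicalPhysics.QuantumLattice.Fock (Literature.MathematicalPhysics.QuantumLattice.Orb (Literature.MathematicalPhysics.QuantumLattice.FermionTorus 2 L)), Literature.MathematicalPhysics.QuantumLattice.IsGroundStateInSector (Literature.MathematicalPhysics.QuantumLattice.hubbardTorus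 2 L 1 U) (2 * ⌊(1 - δ) * (L : ℝ) ^ 2 / 2⌋₊) 0 φ ∧ star φ ⬝ᵥ φ = 1 ∧ Literature.MathematicalPhysics.QuantumLattice.IsGroundStateInSector (Literature.MathematicalPhysics.QuantumLattice.hubbardTorus 2 L 1 U) (2 * ⌊(1 - δ) * (L : ℝ) ^ 2 / 2⌋₊ - 2) 0 χ ∧ star χ ⬝ᵥ χ = 1 ∧ a' * (L : ℝ) ^ 4 ≤ ‖star χ ⬝ᵥ Matrix.mulVec (Literature.MathematicalPhysics.QuantumLattice.pairField Literature.MathematicalPhysics.QuantumLattice.dWaveFormFactor L) φ‖ ^ 2 := by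
  intro U δ a J γ hδ ha hJ hγ hsmall hgap hgain
  obtain ⟨κ₀, hκ₀, hfin⟩ := floorBridge_of_mesoscopicGain a ha
  obtain ⟨L₁, hL₁⟩ := hgap
  obtain ⟨L₂, hL₂⟩ := hgain
  have hev : ∀ᶠ L : ℕ in Filter.atTop, J L * (L : ℝ) ^ 2 / γ L < κ₀ := hsmall (Iio_mem_nhds hκ₀)
  obtain ⟨L₃, hL₃⟩ := Filter.eventually_atTop.1 hev
  refine ⟨a / 4, by positivity, max (max 4 L₁) (max L₂ L₃), fun L _ hE hL => ?_⟩
  have h4 : 4 ≤ L := le_trans (le_max_left _ _) (le_trans (le_max_left _ _) hL)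
  have h1 : L₁ ≤ L := le_trans (le_max_right _ _) (le_trans (le_max_left _ _) hL)
  have h2 : L₂ ≤ L := le_trans (le_max_left _ _) (le_trans (le_max_right _ _) hL)
  have h3 : L₃ ≤ L := le_trans (le_max_right _ _) (le_trans (le_max_right _ _) hL)
  have hJγ : J L * (L : ℝ) ^ 2 ≤ κ₀ * γ L := by
    have h := hL₃ L h3
    rw [div_lt_iff₀ (hγ L)] at h
    exact h.le
  exact hfin L U δ (J L) (γ L) hE h4 hδ (hJ L) (hγ L) hJγ (hL₁ L hE h1) (hL₂ L hE h2)

end Summit.HubbardSuperconductivity.HubbardSuperconductivity.Theorems.JosephsonMirror
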